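import Mathlib
import HarnessLib
import Literature.MathematicalPhysics.StatisticalMechanics.InitialActivityJointSecondDiff
import Literature.MathematicalPhysics.StatisticalMechanics.SecondOrderCountingBounds

/-!
# [ABKM19] Lemma 12.2 (`j₁ + j₂ = 2`), weak-norm form: the joint mixed second differences of
# `K̂_0(𝒦, ℋ) = e^{−ℋ}∏𝒦` are `O((‖U‖ + ‖Y‖)(‖V‖ + ‖Z‖))` in `‖·‖_0^{(A)}`, uniformly in the volume

Continuation of `InitialActivityJointSecondDiff.lean` (the polymer-level `T_φ` bound with an explicit
`|X|`-dependent constant) and `SecondOrderCountingBounds.lean` (the factors `|X|^{j₁+j₂}` against the gain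
`2^{−|X|}`).  Under the smallness `(e^{1/4} + α + β + γ)·(ρ+u+v)e^{𝔥_0}·A ≤ ½` the `|X|`-dependent constant
times `A^{|X|}` is bounded by the BILINEAR quantity
`6αβ(tA)² + γ·tA + 6α·v e^{𝔥_0}A + 6β·u e^{𝔥_0}A + 6uv(e^{𝔥_0}e^{1/4}A)²` (`t = (ρ+u+v)e^{𝔥_0}`,
`α = 16e^{3/8}‖Y‖`, `β = 16e^{3/8}‖Z‖`, `γ = 256e^{1/4}‖Y‖‖Z‖`), whence

* **`weakNormLE_initKH_jointSecondDiff`** — `‖Σ± K̂_0(𝒦 + iU + jV, ℋ + iY + jZ)‖_0^{(A)} ≤` that quantity.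

This is [ABKM19] Lemma 12.2 at total order two in difference form for complex perturbations, i.e. the
hypothesis `hμ12` (joint parallelogram second differences of the initial activity) of the second-order
fixed-point theorem `RGFlow.secondDiff_initial_le_of_isTunedQ`, up to the bundling into `initAct`.
Everything is proved; no named fact.

## References
* S. Adams, S. Buchholz, R. Kotecký, S. Müller, arXiv:1910.13564, Lemma 12.2 (12.9)–(12.10), (12.20)
  [AdamsBuchholzKoteckyMuller2019].
-/

noncomputable section

namespace Literature.MathematicalPhysics.StatisticalMechanics.GradientRG

open scoped BigOperators Classical
open Finset Matrix
open Literature.MathematicalPhysics.StatisticalMechanics.TorusPolymer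
  (IsPolymer blocks bprod blockOf thicken numBlocks mem_blocks subset_thicken thicken_mono
    isPolymer_empty card_blocks_eq_numBlocks)
open Literature.MathematicalPhysics.QuantumFieldTheory

variable {d M : ℕ} [NeZero M]

/-! ## Absorbing the combinatorial factors -/

omit [NeZero M] in
/-- `m(m−1)Y^{m−2}T^m ≤ 6T²` when `YT ≤ ½` (`Y, T ≥ 0`). [cite: AdamsBuchholzKoteckyMuller2019, Lemma 12.3 (12.20)] -/
theorem mul_pred_pow_mul_pow_le {Y T : ℝ} (hY : 0 ≤ Y) (hT : 0 ≤ T) (h : Y * T ≤ 1 / 2) (m : ℕ) :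
    (m : ℝ) * ((m : ℝ) - 1) * Y ^ (m - 2) * T ^ m ≤ 6 * T ^ 2 := by
  match m with
  | 0 => simp; positivity
  | 1 => simp; positivity
  | n + 2 =>
    have h1 := succ_succ_mul_succ_mul_pow_le_six (mul_nonneg hY hT) h n
    have e1 : ((n + 2 : ℕ) : ℝ) = (n : ℝ) + 2 := by push_cast; ring
    rw [e1, show n + 2 - 2 = n from rfl, show ((n : ℝ) + 2 - 1) = (n : ℝ) + 1 by ring]
    calc ((n : ℝ) + 2) * ((n : ℝ) + 1) * Y ^ n * T ^ (n + 2)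
        = T ^ 2 * (((n : ℝ) + 2) * ((n : ℝ) + 1) * (Y * T) ^ n) := by rw [mul_pow]; ring
      _ ≤ T ^ 2 * 6 := mul_le_mul_of_nonneg_left h1 (pow_nonneg hT 2)
      _ = 6 * T ^ 2 := by ring

omit [NeZero M] in
/-- `m·Y^{m−1}T^m ≤ T` when `YT ≤ ½` (`Y, T ≥ 0`). [cite: AdamsBuchholzKoteckyMuller2019, Lemma 12.3 (12.20)] -/
theorem mul_pow_pred_mul_pow_le {Y T : ℝ} (hY : 0 ≤ Y) (hT : 0 ≤ T) (h : Y * T ≤ 1 / 2) (m : ℕ) :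
    (m : ℝ) * Y ^ (m - 1) * T ^ m ≤ T := by
  match m with
  | 0 => simp; exact hT
  | n + 1 =>
    have h1 := succ_mul_pow_le_one_of_le_half (mul_nonneg hY hT) h n
    rw [show n + 1 - 1 = n from rfl]
    push_cast
    calc ((n : ℝ) + 1) * Y ^ n * T ^ (n + 1) = T * (((n : ℝ) + 1) * (Y * T) ^ n) := by rw [mul_pow]; ring
      _ ≤ T * 1 := mul_le_mul_of_nonneg_left h1 hT
      _ = T := mul_one T

omit [NeZero M] in
/-- `m²·Y^{m−1}T^m ≤ 6T` when `YT ≤ ½` (`Y, T ≥ 0`). [cite: AdamsBuchholzKoteckyMuller2019, Lemma 12.3 (12.20)] -/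
theorem sq_mul_pow_pred_mul_pow_le {Y T : ℝ} (hY : 0 ≤ Y) (hT : 0 ≤ T) (h : Y * T ≤ 1 / 2) (m : ℕ) :
    (m : ℝ) ^ 2 * Y ^ (m - 1) * T ^ m ≤ 6 * T := by
  match m with
  | 0 => simp; positivity
  | n + 1 =>
    have h1 := sq_succ_mul_pow_le_six (mul_nonneg hY hT) h n
    rw [show n + 1 - 1 = n from rfl]
    push_cast
    calc ((n : ℝ) + 1) ^ 2 * Y ^ n * T ^ (n + 1) = T * (((n : ℝ) + 1) ^ 2 * (Y * T) ^ n) := by rw [mul_pow]; ring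
      _ ≤ T * 6 := mul_le_mul_of_nonneg_left h1 hT
      _ = 6 * T := by ring

/-! ## The weak-norm bound -/

section Weak

variable {L N Mord R n p r₀ : ℕ} {θbar lam μ δ₁ δ₀ A𝒫 h A : ℝ} {𝒞 : ℕ → (Fin d → ZMod M) → ℝ}

/-- **Joint mixed second differences of `K̂_0(𝒦, ℋ)` in the weak norm `‖·‖_0^{(A)}`** ([ABKM19] Lemma 12.2
with `j₁ + j₂ = 2`, difference form, complex perturbations, torus data).  With `t = (ρ+u+v)e^{𝔥_0}`,
`a = e^{1/4}`, `α = 16e^{3/8}‖Y‖`, `β = 16e^{3/8}‖Z‖`, `γ = 256e^{1/4}‖Y‖‖Z‖` and the smallness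
`(a + α + β + γ)·t·A ≤ ½`:
`‖Σ± K̂_0(𝒦+iU+jV, ℋ+iY+jZ)‖_0^{(A)} ≤ 6αβ(tA)² + γ·tA + 6α·ve^{𝔥_0}A + 6β·ue^{𝔥_0}A + 6uv(e^{𝔥_0}aA)²`.
[cite: AdamsBuchholzKoteckyMuller2019, Lemma 12.2 (12.9)] -/
theorem weakNormLE_initKH_jointSecondDiff (hd : 2 ≤ d) (hLodd : Odd L) (hM : M = L ^ N)
    (hp : d / 2 + 1 ≤ p) (hMord : d / 2 + 1 ≤ Mord)
    (hB : AbkmWeightBounds L N Mord R n θbar lam μ δ₁ δ₀ A𝒫 𝒞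
      (abkmWeightData L N Mord R θbar (schedDelta δ₀ δ₁ N) 𝒞))
    (hδ₀ : 0 < δ₀) (hδ₁ : 0 < δ₁) (hh : 0 < h) (hh0 : hZeroSq d R δ₀ δ₁ ≤ h ^ 2) (hA : 0 < A)
    {𝒦 U V : (Fin d → ℝ) → ℂ} {ρ u v : ℝ}
    (h𝒦 : ContDiff ℝ r₀ 𝒦) (hU : ContDiff ℝ r₀ U) (hV : ContDiff ℝ r₀ V)
    (h𝒦b : ∀ k, k ≤ r₀ → ∀ z : Fin d → ℝ, ‖iteratedFDeriv ℝ k 𝒦 z‖ ≤ ρ * Real.exp ((∑ i, z i ^ 2) / 4))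
    (hUb : ∀ k, k ≤ r₀ → ∀ z : Fin d → ℝ, ‖iteratedFDeriv ℝ k U z‖ ≤ u * Real.exp ((∑ i, z i ^ 2) / 4))
    (hVb : ∀ k, k ≤ r₀ → ∀ z : Fin d → ℝ, ‖iteratedFDeriv ℝ k V z‖ ≤ v * Real.exp ((∑ i, z i ^ 2) / 4))
    {H Y Z : RelevantHamiltonian ℂ d}
    (hH : hamNorm (fieldWt h (L : ℝ) d 0) ((L : ℝ) ^ 0) (L ^ (d * 0)) H ≤ 1 / 16)
    (hHY : hamNorm (fieldWt h (L : ℝ) d 0) ((L : ℝ) ^ 0) (L ^ (d * 0)) (H + Y) ≤ 1 / 16)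
    (hHZ : hamNorm (fieldWt h (L : ℝ) d 0) ((L : ℝ) ^ 0) (L ^ (d * 0)) (H + Z) ≤ 1 / 16)
    (hHYZ : hamNorm (fieldWt h (L : ℝ) d 0) ((L : ℝ) ^ 0) (L ^ (d * 0)) (H + Y + Z) ≤ 1 / 16)
    (hY : hamNorm (fieldWt h (L : ℝ) d 0) ((L : ℝ) ^ 0) (L ^ (d * 0)) Y ≤ 1 / 32)
    (hZ : hamNorm (fieldWt h (L : ℝ) d 0) ((L : ℝ) ^ 0) (L ^ (d * 0)) Z ≤ 1 / 32)
    (hsmall : (Real.exp (1 / 4) + 16 * Real.exp (3 / 8) * hamNorm (fieldWt h (L : ℝ) d 0) ((L : ℝ) ^ 0) (L ^ (d * 0)) Y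
        + 16 * Real.exp (3 / 8) * hamNorm (fieldWt h (L : ℝ) d 0) ((L : ℝ) ^ 0) (L ^ (d * 0)) Z
        + 256 * Real.exp (1 / 4) * hamNorm (fieldWt h (L : ℝ) d 0) ((L : ℝ) ^ 0) (L ^ (d * 0)) Y
          * hamNorm (fieldWt h (L : ℝ) d 0) ((L : ℝ) ^ 0) (L ^ (d * 0)) Z)
        * ((ρ + u + v) * Real.exp (fieldWt h (L : ℝ) d 0 / (L : ℝ) ^ 0)) * A ≤ 1 / 2) :
    WeakNormLE (abkmNormParams L N Mord R p r₀ h θbar A (schedDelta δ₀ δ₁ N) 𝒞) 0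
      (fun X φ => initKH (fun z => 𝒦 z + U z + V z) (H + Y + Z) X φ - initKH (fun z => 𝒦 z + U z) (H + Y) X φ
        - initKH (fun z => 𝒦 z + V z) (H + Z) X φ + initKH 𝒦 H X φ)
      (6 * (16 * Real.exp (3 / 8) * hamNorm (fieldWt h (L : ℝ) d 0) ((L : ℝ) ^ 0) (L ^ (d * 0)) Y) * (16 * Real.exp (3 / 8) * hamNorm (fieldWt h (L : ℝ) d 0) ((L : ℝ) ^ 0) (L ^ (d * 0)) Z) * (((ρ + u + v) * Real.exp (fieldWt h (L : ℝ) d 0 / (L : ℝ) ^ 0)) * A) ^ 2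
        + (256 * Real.exp (1 / 4) * hamNorm (fieldWt h (L : ℝ) d 0) ((L : ℝ) ^ 0) (L ^ (d * 0)) Y * hamNorm (fieldWt h (L : ℝ) d 0) ((L : ℝ) ^ 0) (L ^ (d * 0)) Z) * (((ρ + u + v) * Real.exp (fieldWt h (L : ℝ) d 0 / (L : ℝ) ^ 0)) * A)
        + 6 * (16 * Real.exp (3 / 8) * hamNorm (fieldWt h (L : ℝ) d 0) ((L : ℝ) ^ 0) (L ^ (d * 0)) Y) * (v * Real.exp (fieldWt h (L : ℝ) d 0 / (L : ℝ) ^ 0) * A)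
        + 6 * (16 * Real.exp (3 / 8) * hamNorm (fieldWt h (L : ℝ) d 0) ((L : ℝ) ^ 0) (L ^ (d * 0)) Z) * (u * Real.exp (fieldWt h (L : ℝ) d 0 / (L : ℝ) ^ 0) * A)
        + 6 * u * v * (Real.exp (fieldWt h (L : ℝ) d 0 / (L : ℝ) ^ 0) * Real.exp (1 / 4) * A) ^ 2) := by
  set P := abkmNormParams L N Mord R p r₀ h θbar A (schedDelta δ₀ δ₁ N) 𝒞 with hP
  set W := abkmWeightData L N Mord R θbar (schedDelta δ₀ δ₁ N) 𝒞 with hW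
  set nY := hamNorm (fieldWt h (L : ℝ) d 0) ((L : ℝ) ^ 0) (L ^ (d * 0)) Y with hnY
  set nZ := hamNorm (fieldWt h (L : ℝ) d 0) ((L : ℝ) ^ 0) (L ^ (d * 0)) Z with hnZ
  set e' := Real.exp (fieldWt h (L : ℝ) d 0 / (L : ℝ) ^ 0) with he'
  set a := Real.exp (1 / 4) with ha
  set α := 16 * Real.exp (3 / 8) * nY with hα
  set β := 16 * Real.exp (3 / 8) * nZ with hβ
  set γ := 256 * Real.exp (1 / 4) * nY * nZ with hγ
  set t := (ρ + u + v) * e' with ht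
  have hL0 : (0 : ℝ) < L := by exact_mod_cast hLodd.pos
  have h𝔥 : 0 < fieldWt h (L : ℝ) d 0 := fieldWt_pos hh hL0 d 0
  have hR0 : (0 : ℝ) < (L : ℝ) ^ 0 := by positivity
  have nonneg_of : ∀ {F : (Fin d → ℝ) → ℂ} {s : ℝ},
      (∀ k, k ≤ r₀ → ∀ z : Fin d → ℝ, ‖iteratedFDeriv ℝ k F z‖ ≤ s * Real.exp ((∑ i, z i ^ 2) / 4)) → 0 ≤ s :=
    fun hb => by
      have h0 := (norm_nonneg _).trans (hb 0 (Nat.zero_le _) 0)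
      exact (mul_nonneg_iff_of_pos_right (Real.exp_pos _)).1 h0
  have hρ : 0 ≤ ρ := nonneg_of h𝒦b
  have hu : 0 ≤ u := nonneg_of hUb
  have hv : 0 ≤ v := nonneg_of hVb
  have he'0 : 0 < e' := by rw [he']; exact Real.exp_pos _
  have hnY0 : 0 ≤ nY := by rw [hnY]; exact hamNorm_nonneg h𝔥.le hR0.le _ _
  have hnZ0 : 0 ≤ nZ := by rw [hnZ]; exact hamNorm_nonneg h𝔥.le hR0.le _ _
  have ha0 : 0 < a := by rw [ha]; exact Real.exp_pos _
  have h38 : 0 < Real.exp (3 / 8) := Real.exp_pos _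
  have hα0 : 0 ≤ α := by rw [hα]; exact mul_nonneg (mul_nonneg (by norm_num) h38.le) hnY0
  have hβ0 : 0 ≤ β := by rw [hβ]; exact mul_nonneg (mul_nonneg (by norm_num) h38.le) hnZ0
  have hγ0 : 0 ≤ γ := by
    rw [hγ]; exact mul_nonneg (mul_nonneg (mul_nonneg (by norm_num) (Real.exp_pos _).le) hnY0) hnZ0
  have hρuv : 0 ≤ ρ + u + v := by linarith
  have ht0 : 0 ≤ t := by rw [ht]; exact mul_nonneg hρuv he'0.le
  have htA0 : 0 ≤ t * A := mul_nonneg ht0 hA.le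
  -- the individual smallness conditions
  have hq : (a + α + β + γ) * (t * A) ≤ 1 / 2 := by
    have e : (a + α + β + γ) * (t * A) = (a + α + β + γ) * t * A := by ring
    rw [e]; exact hsmall
  have mono_q : ∀ {y : ℝ}, y ≤ a + α + β + γ → y * (t * A) ≤ 1 / 2 := fun hy =>
    le_trans (mul_le_mul_of_nonneg_right hy htA0) hq
  have hq1 : (a + α + β) * (t * A) ≤ 1 / 2 := mono_q (by linarith)
  have hq2 : (a + γ) * (t * A) ≤ 1 / 2 := mono_q (by linarith)
  have hq3 : (a + α) * (t * A) ≤ 1 / 2 := mono_q (by linarith)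
  have hq4 : (a + β) * (t * A) ≤ 1 / 2 := mono_q (by linarith)
  have hq5 : t * (a * A) ≤ 1 / 2 := by
    have e : t * (a * A) = a * (t * A) := by ring
    rw [e]; exact mono_q (by linarith)
  intro X hX hXc
  set m := X.card with hm
  have h := tayNormLE_initKH_jointSecondDiff (p := p) (r₀ := r₀) (A := A) hd hLodd hM hp hMord hB hδ₀ hδ₁ hh hh0
    h𝒦 hU hV h𝒦b hUb hVb hH hHY hHZ hHYZ hY hZ X
  dsimp only at h
  rw [← hnY, ← hnZ, ← he', ← ha, ← hα, ← hβ, ← hγ, ← ht, ← hm] at h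
  refine h.mono ?_ fun φ => (W.weight_pos 0 X φ).le
  -- the constant: `C(m) ≤ C_fin · A^{−m}`
  have haF : P.aFactor 0 X = (A ^ m)⁻¹ := by
    show (A ^ numBlocks (L ^ 0) X)⁻¹ = _
    rw [numBlocks_pow_zero]
  rw [haF, ← div_eq_mul_inv, le_div_iff₀ (pow_pos hA _)]
  -- the elementary bounds on the numerical differences
  have b1 : (a + α + β) ^ m - (a + α) ^ m - ((a + β) ^ m - a ^ m)
      ≤ (m : ℝ) * ((m : ℝ) - 1) * α * β * (a + α + β) ^ (m - 2) := by
    have h := secondDiff_pow_le ha0.le hα0 hβ0 m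
    linarith
  have b1' : (a + γ) ^ m - a ^ m ≤ (m : ℝ) * γ * (a + γ) ^ (m - 1) := pow_add_sub_pow_le ha0.le hγ0 m
  have b2 : (a + α) ^ m - a ^ m ≤ (m : ℝ) * α * (a + α) ^ (m - 1) := pow_add_sub_pow_le ha0.le hα0 m
  have b3 : (a + β) ^ m - a ^ m ≤ (m : ℝ) * β * (a + β) ^ (m - 1) := pow_add_sub_pow_le ha0.le hβ0 m
  have b2' : t ^ m - ((ρ + u) * e') ^ m ≤ (m : ℝ) * (v * e') * t ^ (m - 1) := by
    have h := pow_add_sub_pow_le (x := (ρ + u) * e') (δ := v * e') (mul_nonneg (by linarith) he'0.le)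
      (mul_nonneg hv he'0.le) m
    have e1 : (ρ + u) * e' + v * e' = t := by rw [ht]; ring
    rw [e1] at h
    exact h
  have b3' : t ^ m - ((ρ + v) * e') ^ m ≤ (m : ℝ) * (u * e') * t ^ (m - 1) := by
    have h := pow_add_sub_pow_le (x := (ρ + v) * e') (δ := u * e') (mul_nonneg (by linarith) he'0.le)
      (mul_nonneg hu he'0.le) m
    have e1 : (ρ + v) * e' + u * e' = t := by rw [ht]; ring
    rw [e1] at h
    exact h
  have b4 : (t ^ m - ((ρ + u) * e') ^ m) - (((ρ + v) * e') ^ m - (ρ * e') ^ m)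
      ≤ (m : ℝ) * ((m : ℝ) - 1) * (u * e') * (v * e') * t ^ (m - 2) := by
    have h := secondDiff_pow_le (x := ρ * e') (δ := u * e') (δ' := v * e') (mul_nonneg hρ he'0.le)
      (mul_nonneg hu he'0.le) (mul_nonneg hv he'0.le) m
    have e1 : ρ * e' + u * e' + v * e' = t := by rw [ht]; ring
    have e2 : ρ * e' + u * e' = (ρ + u) * e' := by ring
    have e3 : ρ * e' + v * e' = (ρ + v) * e' := by ring
    rw [e1, e2, e3] at h
    linarith
  -- nonnegativity of the differences
  have hmono : ∀ {x y : ℝ}, 0 ≤ x → x ≤ y → x ^ m ≤ y ^ m := fun hx hxy => pow_le_pow_left₀ hx hxy _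
  have n1 : 0 ≤ (a + γ) ^ m - a ^ m := sub_nonneg.2 (hmono ha0.le (by linarith))
  have n2 : 0 ≤ (a + α) ^ m - a ^ m := sub_nonneg.2 (hmono ha0.le (by linarith))
  have n3 : 0 ≤ (a + β) ^ m - a ^ m := sub_nonneg.2 (hmono ha0.le (by linarith))
  have n2' : 0 ≤ t ^ m - ((ρ + u) * e') ^ m :=
    sub_nonneg.2 (hmono (mul_nonneg (by linarith) he'0.le)
      (by rw [ht]; exact mul_le_mul_of_nonneg_right (by linarith) he'0.le))
  have n3' : 0 ≤ t ^ m - ((ρ + v) * e') ^ m :=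
    sub_nonneg.2 (hmono (mul_nonneg (by linarith) he'0.le)
      (by rw [ht]; exact mul_le_mul_of_nonneg_right (by linarith) he'0.le))
  have ntm : 0 ≤ t ^ m := pow_nonneg ht0 _
  have nam : 0 ≤ a ^ m := pow_nonneg ha0.le _
  have nAm : 0 ≤ A ^ m := pow_nonneg hA.le _
  -- the absorbed bounds
  have c1 : ((m : ℝ) * ((m : ℝ) - 1) * α * β * (a + α + β) ^ (m - 2)) * t ^ m * A ^ m
      ≤ 6 * α * β * (t * A) ^ 2 := by
    have h := mul_pred_pow_mul_pow_le (Y := a + α + β) (T := t * A) (by linarith) htA0 hq1 m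
    calc ((m : ℝ) * ((m : ℝ) - 1) * α * β * (a + α + β) ^ (m - 2)) * t ^ m * A ^ m
        = α * β * ((m : ℝ) * ((m : ℝ) - 1) * (a + α + β) ^ (m - 2) * (t * A) ^ m) := by
          rw [show (t * A) ^ m = t ^ m * A ^ m from mul_pow t A m]; ring
      _ ≤ α * β * (6 * (t * A) ^ 2) := mul_le_mul_of_nonneg_left h (mul_nonneg hα0 hβ0)
      _ = 6 * α * β * (t * A) ^ 2 := by ring
  have c1' : ((m : ℝ) * γ * (a + γ) ^ (m - 1)) * t ^ m * A ^ m ≤ γ * (t * A) := by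
    have h := mul_pow_pred_mul_pow_le (Y := a + γ) (T := t * A) (by linarith) htA0 hq2 m
    calc ((m : ℝ) * γ * (a + γ) ^ (m - 1)) * t ^ m * A ^ m
        = γ * ((m : ℝ) * (a + γ) ^ (m - 1) * (t * A) ^ m) := by
          rw [show (t * A) ^ m = t ^ m * A ^ m from mul_pow t A m]; ring
      _ ≤ γ * (t * A) := mul_le_mul_of_nonneg_left h hγ0
  have c2 : ((m : ℝ) * α * (a + α) ^ (m - 1)) * ((m : ℝ) * (v * e') * t ^ (m - 1)) * A ^ m
      ≤ 6 * α * (v * e' * A) := by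
    have h := sq_mul_pow_pred_mul_pow_le (Y := (a + α) * t) (T := A) (mul_nonneg (by linarith) ht0) hA.le
      (by calc (a + α) * t * A = (a + α) * (t * A) := by ring
             _ ≤ 1 / 2 := hq3) m
    calc ((m : ℝ) * α * (a + α) ^ (m - 1)) * ((m : ℝ) * (v * e') * t ^ (m - 1)) * A ^ m
        = α * (v * e') * ((m : ℝ) ^ 2 * ((a + α) * t) ^ (m - 1) * A ^ m) := by
          rw [show ((a + α) * t) ^ (m - 1) = (a + α) ^ (m - 1) * t ^ (m - 1) from mul_pow _ _ _]; ring
      _ ≤ α * (v * e') * (6 * A) := mul_le_mul_of_nonneg_left h (mul_nonneg hα0 (mul_nonneg hv he'0.le))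
      _ = 6 * α * (v * e' * A) := by ring
  have c3 : ((m : ℝ) * β * (a + β) ^ (m - 1)) * ((m : ℝ) * (u * e') * t ^ (m - 1)) * A ^ m
      ≤ 6 * β * (u * e' * A) := by
    have h := sq_mul_pow_pred_mul_pow_le (Y := (a + β) * t) (T := A) (mul_nonneg (by linarith) ht0) hA.le
      (by calc (a + β) * t * A = (a + β) * (t * A) := by ring
             _ ≤ 1 / 2 := hq4) m
    calc ((m : ℝ) * β * (a + β) ^ (m - 1)) * ((m : ℝ) * (u * e') * t ^ (m - 1)) * A ^ m
        = β * (u * e') * ((m : ℝ) ^ 2 * ((a + β) * t) ^ (m - 1) * A ^ m) := by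
          rw [show ((a + β) * t) ^ (m - 1) = (a + β) ^ (m - 1) * t ^ (m - 1) from mul_pow _ _ _]; ring
      _ ≤ β * (u * e') * (6 * A) := mul_le_mul_of_nonneg_left h (mul_nonneg hβ0 (mul_nonneg hu he'0.le))
      _ = 6 * β * (u * e' * A) := by ring
  have c4 : a ^ m * ((m : ℝ) * ((m : ℝ) - 1) * (u * e') * (v * e') * t ^ (m - 2)) * A ^ m
      ≤ 6 * u * v * (e' * a * A) ^ 2 := by
    have h := mul_pred_pow_mul_pow_le (Y := t) (T := a * A) ht0 (mul_nonneg ha0.le hA.le) hq5 m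
    calc a ^ m * ((m : ℝ) * ((m : ℝ) - 1) * (u * e') * (v * e') * t ^ (m - 2)) * A ^ m
        = u * v * e' ^ 2 * ((m : ℝ) * ((m : ℝ) - 1) * t ^ (m - 2) * (a * A) ^ m) := by
          rw [show (a * A) ^ m = a ^ m * A ^ m from mul_pow a A m]; ring
      _ ≤ u * v * e' ^ 2 * (6 * (a * A) ^ 2) :=
          mul_le_mul_of_nonneg_left h (mul_nonneg (mul_nonneg hu hv) (pow_nonneg he'0.le 2))
      _ = 6 * u * v * (e' * a * A) ^ 2 := by ring
  -- assemble
  have T1 : (((a + α + β) ^ m - (a + α) ^ m - ((a + β) ^ m - a ^ m)) + ((a + γ) ^ m - a ^ m)) * t ^ m * A ^ m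
      ≤ 6 * α * β * (t * A) ^ 2 + γ * (t * A) := by
    have h1 : (((a + α + β) ^ m - (a + α) ^ m - ((a + β) ^ m - a ^ m)) + ((a + γ) ^ m - a ^ m)) * t ^ m * A ^ m
        ≤ (((m : ℝ) * ((m : ℝ) - 1) * α * β * (a + α + β) ^ (m - 2)) + ((m : ℝ) * γ * (a + γ) ^ (m - 1)))
          * t ^ m * A ^ m :=
      mul_le_mul_of_nonneg_right (mul_le_mul_of_nonneg_right (add_le_add b1 b1') ntm) nAm
    refine h1.trans ?_
    rw [add_mul, add_mul]
    exact add_le_add c1 c1'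
  have T2 : ((a + α) ^ m - a ^ m) * (t ^ m - ((ρ + u) * e') ^ m) * A ^ m ≤ 6 * α * (v * e' * A) := by
    refine le_trans ?_ c2
    exact mul_le_mul_of_nonneg_right (mul_le_mul b2 b2' n2' (le_trans n2 b2)) nAm
  have T3 : ((a + β) ^ m - a ^ m) * (t ^ m - ((ρ + v) * e') ^ m) * A ^ m ≤ 6 * β * (u * e' * A) := by
    refine le_trans ?_ c3
    exact mul_le_mul_of_nonneg_right (mul_le_mul b3 b3' n3' (le_trans n3 b3)) nAm
  have T4 : a ^ m * ((t ^ m - ((ρ + u) * e') ^ m) - (((ρ + v) * e') ^ m - (ρ * e') ^ m)) * A ^ m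
      ≤ 6 * u * v * (e' * a * A) ^ 2 := by
    refine le_trans ?_ c4
    exact mul_le_mul_of_nonneg_right (mul_le_mul_of_nonneg_left b4 nam) nAm
  calc ((((a + α + β) ^ m - (a + α) ^ m - ((a + β) ^ m - a ^ m)) + ((a + γ) ^ m - a ^ m)) * t ^ m
        + ((a + α) ^ m - a ^ m) * (t ^ m - ((ρ + u) * e') ^ m)
        + ((a + β) ^ m - a ^ m) * (t ^ m - ((ρ + v) * e') ^ m)
        + a ^ m * ((t ^ m - ((ρ + u) * e') ^ m) - (((ρ + v) * e') ^ m - (ρ * e') ^ m))) * A ^ m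
      = (((a + α + β) ^ m - (a + α) ^ m - ((a + β) ^ m - a ^ m)) + ((a + γ) ^ m - a ^ m)) * t ^ m * A ^ m
        + ((a + α) ^ m - a ^ m) * (t ^ m - ((ρ + u) * e') ^ m) * A ^ m
        + ((a + β) ^ m - a ^ m) * (t ^ m - ((ρ + v) * e') ^ m) * A ^ m
        + a ^ m * ((t ^ m - ((ρ + u) * e') ^ m) - (((ρ + v) * e') ^ m - (ρ * e') ^ m)) * A ^ m := by ring
    _ ≤ (6 * α * β * (t * A) ^ 2 + γ * (t * A)) + 6 * α * (v * e' * A) + 6 * β * (u * e' * A)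
        + 6 * u * v * (e' * a * A) ^ 2 := add_le_add (add_le_add (add_le_add T1 T2) T3) T4
    _ = 6 * α * β * (t * A) ^ 2 + γ * (t * A) + 6 * α * (v * e' * A) + 6 * β * (u * e' * A)
        + 6 * u * v * (e' * a * A) ^ 2 := by ring

end Weak

end Literature.MathematicalPhysics.StatisticalMechanics.GradientRG

end
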